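import Summits.QuantumFields.YangMills.Theorems.F4SubCurvatureDoorHexagonPolynomial
import Mathlib
import HarnessLib

/-!
# Hexagon normal form — which half of the Wick test carries the polynomial hexagon theorem (sharpness remark)

Support remark for crux `stmt-QuantumFields-23125` (`F4SubCurvatureDoor.RationalToGeneral`), companion of the polynomial hexagon
theorem `wickHexagon_poly_eq_zero` (`F4SubCurvatureDoorHexagonPolynomialFinal.lean`): `WickHexagon F G` asks that every zero of
`Φ_s = F + P_s G` (`s ≥ 0`) be REAL and `≤ s`.  The reality half alone does NOT force `G = 0` in the polynomial class:

* `hexagon_realityHalf_insufficient` — the pair `F = 1 − w³`, `G = 1` has `Φ_s(w) = 1 − 2s(3w − 4s)²`, whose zeros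
  `w = (4s ± (2s)^{-1/2})/3` are real for every `s > 0` (and there are none at `s = 0`); they violate the bound `w ≤ s`, which is
  therefore the operative half in all four cases of the polynomial theorem (roots `2s`, `4s/3`, `> s` at scale `s^{3/(f−g)}`).

Mathlib only (plus the pencil identity `aeval_pencil`/`P_expand` of the companion files); THEOREMS ONLY; no `sorry`.  Nothing about
crux 23125, crux 23035, any LADDER-YM rung or the Yang–Mills mass gap is proved here.  Free-hands seat `ym-line-frs-p2` g10,
`--supports stmt-QuantumFields-23125`.
-/

set_option autoImplicit false

open Polynomial

namespace Summit.QuantumFields.YangMills.Cruxes.RationalToGeneral.HexagonNormalForm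

/-- A complex number with positive real square is real. -/
theorem im_eq_zero_of_sq_eq_pos (w : ℂ) (r : ℝ) (hr : 0 < r) (h : w ^ 2 = (r : ℂ)) : w.im = 0 := by
  have hre := congrArg Complex.re h
  have him := congrArg Complex.im h
  simp only [sq, Complex.mul_re, Complex.mul_im, Complex.ofReal_re, Complex.ofReal_im] at hre him
  by_contra hb
  have ha : w.re = 0 := by
    have : 2 * w.re * w.im = 0 := by linarith
    rcases mul_eq_zero.1 this with h1 | h1
    · rcases mul_eq_zero.1 h1 with h2 | h2
      · norm_num at h2
      · exact h2
    · exact absurd h1 hb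
  rw [ha, zero_mul, zero_sub] at hre
  nlinarith [mul_self_nonneg w.im]

/-- **The reality half of the hexagon Wick test does not force `G = 0`** (polynomial class): for `F = 1 − w³`, `G = 1` every zero of
`F + P_s G = 1 − 2s(3w − 4s)²` is real for every `s ≥ 0` — the bound `Re w ≤ s` is the operative half of `WickHexagon`. [folklore] -/
theorem hexagon_realityHalf_insufficient : ∃ F G : ℝ[X], G ≠ 0 ∧
    ∀ s : ℝ, 0 ≤ s → ∀ z : ℂ, Polynomial.aeval z F + P s z * Polynomial.aeval z G = 0 → z.im = 0 := by
  refine ⟨1 - X ^ 3, 1, one_ne_zero, ?_⟩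
  intro s hs z hz
  rw [P_expand] at hz
  simp only [map_sub, map_one, map_pow, Polynomial.aeval_X, mul_one] at hz
  -- `1 − 2s(3z − 4s)² = 0`
  have hid : (2 * s : ℂ) * (3 * z - 4 * s) ^ 2 = 1 := by linear_combination (-1 : ℂ) * hz
  rcases hs.eq_or_lt with h0 | hpos
  · rw [← h0] at hid; norm_num at hid
  · have hsC : (s : ℂ) ≠ 0 := Complex.ofReal_ne_zero.2 hpos.ne'
    have hsq : (3 * z - 4 * s) ^ 2 = (((2 * s)⁻¹ : ℝ) : ℂ) := by
      rw [Complex.ofReal_inv]; push_cast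
      field_simp
      linear_combination hid
    have him := im_eq_zero_of_sq_eq_pos _ _ (by positivity) hsq
    have h3 : (3 * z - 4 * (s : ℂ)).im = 3 * z.im := by simp
    rw [h3] at him
    linarith

end Summit.QuantumFields.YangMills.Cruxes.RationalToGeneral.HexagonNormalForm
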